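import Literature.Topology.FourManifolds.WeaklyReducibleTrisections
import Mathlib.Analysis.Normed.Module.Connected

/-!
# Crux `WeakReductionDescent.MinimalWeaklyReducibleFromFour` (stmt-SmoothPoincare4-18019), line `Sketch`
# (spine A = KCap), stub `stub_twoSided`: the two-sidedness lemma (point-set topology)

In the KCap line a label `p` comes with a separating curve `δ` of the central surface `F`, two
`p`-cores `c₁`, `c₂` (non-separating curves bounding compressing discs in both handlebodies `H_q`,
`q ≠ p`) lying off `δ` and on DIFFERENT SIDES of it — no preconnected subset of `F ∖ δ` contains
both — and a non-separating curve `c ⊆ F ∖ δ` bounding a compressing disc in `H_p`.  This file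
proves the registered stub `stub_twoSided`: these data give a weak reduction
(`Trisection.IsWeaklyReducible T`).

Proof.  A curve is the continuous image of the (preconnected) circle, hence preconnected.  If
`c` met both `c₁` and `c₂`, then `c₁ ∪ c ∪ c₂` would be a preconnected subset of `F ∖ δ`
containing both cores, contradicting two-sidedness.  So `c` misses `c₁` or `c₂`, and with that
core it is a weak reduction at the label `p`.  Pure point-set topology over the tree's
definitions (`Literature/Topology/FourManifolds/WeaklyReducibleTrisections.lean`); no fact is used.

## References

* R. Aranda, A. Zupan, *Manifolds with weakly reducible genus-three trisections are standard*,
  arXiv:2503.04607 (2025), §2 (p. 6): weakly reducible trisections. [ArandaZupan2025]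
-/

-- the registered namespace `Summit.SmoothPoincare4.SmoothPoincare4.Theorems…` repeats a component
set_option linter.dupNamespace false

open scoped Manifold ContDiff Topology
open Set
open Literature.Topology.FourManifolds

namespace Summit.SmoothPoincare4.SmoothPoincare4.Theorems.MinimalWeaklyReducibleFromFour.KCap

/-- The unit circle `S¹ ⊂ ℝ²` is preconnected (Mathlib `isPreconnected_sphere`, `dim ℝ² = 2 > 1`).
[folklore] -/
theorem isPreconnected_unitCircle :
    IsPreconnected (Metric.sphere (0 : EuclideanSpace ℝ (Fin 2)) 1) := by
  refine isPreconnected_sphere ?_ 0 1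
  rw [← Module.finrank_eq_rank, finrank_euclideanSpace_fin]
  norm_num

/-- A curve on the central surface (the image of a smooth embedding of the circle) is
preconnected. [folklore] -/
theorem isPreconnected_of_isCurve {M : Type} [TopologicalSpace M]
    [ChartedSpace (EuclideanSpace ℝ (Fin 4)) M] {T : Fin 3 → Set M} {c : Set M}
    (hc : Trisection.IsCurve T c) : IsPreconnected c := by
  obtain ⟨-, γ, hγ, rfl⟩ := hc
  haveI : PreconnectedSpace (Metric.sphere (0 : EuclideanSpace ℝ (Fin 2)) 1) :=
    Subtype.preconnectedSpace isPreconnected_unitCircle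
  exact isPreconnected_range hγ.isEmbedding.continuous

/-- **Two-sidedness (registered stub `stub_twoSided` of crux stmt-SmoothPoincare4-18019, line
`Sketch`, spine KCap).**  Let `c₁`, `c₂` be non-separating curves on the central surface `F`
bounding compressing discs in both handlebodies `H_q` (`q ≠ p`), disjoint from `δ` and on
different sides of `δ` (no preconnected subset of `F ∖ δ` contains both), and let `c` be a
non-separating curve off `δ` bounding a compressing disc in `H_p`.  Then the sectors are weakly
reducible: `c` is preconnected (image of the circle), so it cannot meet both `c₁` and `c₂`
(else `c₁ ∪ c ∪ c₂ ⊆ F ∖ δ` would be preconnected and contain both cores), and `c` together with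
the core it misses is a weak reduction at `p`. [cite: ArandaZupan2025, §2 (p. 6)] -/
theorem stub_twoSided : ∀ (M : Type) [TopologicalSpace M] [ChartedSpace (EuclideanSpace ℝ (Fin 4)) M] (T : Fin 3 → Set M) (p : Fin 3) (δ c₁ c₂ c : Set M), (Literature.Topology.FourManifolds.Trisection.IsCurve T c₁ ∧ Literature.Topology.FourManifolds.Trisection.IsNonSeparating T c₁ ∧ ∀ q : Fin 3, q ≠ p → Literature.Topology.FourManifolds.Trisection.BoundsDisc T (Literature.Topology.FourManifolds.Trisection.spineHandlebody T q) c₁) → (Literature.Topology.FourManifolds.Trisection.IsCurve T c₂ ∧ Literature.Topology.FourManifolds.Trisection.IsNonSeparating T c₂ ∧ ∀ q : Fin 3, q ≠ p → Literature.Topology.FourManifolds.Trisection.BoundsDisc T (Literature.Topology.FourManifolds.Trisection.spineHandlebody T q) c₂) → Disjoint c₁ δ → Disjoint c₂ δ → (∀ S : Set M, S ⊆ Literature.Topology.FourManifolds.Trisection.centralSurfaceSet T \ δ → IsPreconnected S → c₁ ⊆ S → c₂ ⊆ S → False) → Literature.Topology.FourManifolds.Trisection.IsCurve T c → Literature.Topology.FourManifolds.Trisection.IsNonSeparating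 T c → Literature.Topology.FourManifolds.Trisection.BoundsDisc T (Literature.Topology.FourManifolds.Trisection.spineHandlebody T p) c → Disjoint c δ → Literature.Topology.FourManifolds.Trisection.IsWeaklyReducible T := by
  intro M _ _ T p δ c₁ c₂ c hc₁ hc₂ hd₁ hd₂ hsides hc hcns hcp hcδ
  by_cases h₁ : Disjoint c c₁
  · exact ⟨p, c, c₁, hc, hc₁.1, h₁, hcns, hc₁.2.1, hcp, hc₁.2.2⟩
  by_cases h₂ : Disjoint c c₂
  · exact ⟨p, c, c₂, hc, hc₂.1, h₂, hcns, hc₂.2.1, hcp, hc₂.2.2⟩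
  exfalso
  obtain ⟨x, hxc, hx₁⟩ := Set.not_disjoint_iff.1 h₁
  obtain ⟨y, hyc, hy₂⟩ := Set.not_disjoint_iff.1 h₂
  refine hsides (c₁ ∪ c ∪ c₂) ?_ ?_ ?_ ?_
  · refine union_subset (union_subset ?_ ?_) ?_
    · exact fun z hz => ⟨hc₁.1.1 hz, fun hzδ => Set.disjoint_left.1 hd₁ hz hzδ⟩
    · exact fun z hz => ⟨hc.1 hz, fun hzδ => Set.disjoint_left.1 hcδ hz hzδ⟩
    · exact fun z hz => ⟨hc₂.1.1 hz, fun hzδ => Set.disjoint_left.1 hd₂ hz hzδ⟩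
  · have h₁₂ : IsPreconnected (c₁ ∪ c) :=
      (isPreconnected_of_isCurve hc₁.1).union x hx₁ hxc (isPreconnected_of_isCurve hc)
    exact h₁₂.union y (Or.inr hyc) hy₂ (isPreconnected_of_isCurve hc₂.1)
  · exact subset_union_left.trans subset_union_left
  · exact subset_union_right

end Summit.SmoothPoincare4.SmoothPoincare4.Theorems.MinimalWeaklyReducibleFromFour.KCap
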